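import Summits.AtomisticToContinuum.HydrodynamicLimit.Theorems.CollisionIsometryCLTCollisionalTransferLocalityEnvelopeA
import Summits.AtomisticToContinuum.HydrodynamicLimit.Theorems.CollisionIsometryCLTCollisionalTransferLocalityRhsSupOfConstLLN
import Summits.AtomisticToContinuum.HydrodynamicLimit.Theorems.CollisionIsometryCLTCollisionalTransferLocalityMollifiedCeilingConst
import Summits.AtomisticToContinuum.HydrodynamicLimit.Theorems.CollisionIsometryCLTCollisionalTransferLocalityConeValue
import HarnessLib

/-!
# The value `RhsA` at global equilibrium for the cone kernel of fixed radius
(registered stub `stub_rhsA_cone_const`, [R0C] of the equilibrium rung of [TS], line `hemisphere-affine-slaving`,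
crux `CollisionalTransferLocality`, stmt-AtomisticToContinuum-9518; `--supports stmt-AtomisticToContinuum-9518`)

Under the flow-invariant homogeneous local Gibbs law (activity `1`, velocity `0`, temperature `θ`) at small `σ`,
`RhsA[b_r](τ) = ∫₀^τ∫ₓ tr A · p_c(ρ_r, θ_r) → θ (Z(σ³) − 1) ∫₀^τ∫ₓ tr A` in probability for FIXED `τ ≤ t`, GIVEN the
constant-profile LLN of the cone block fields at time `0` (the neighbouring stub `stub_coneLLNConst`, a hypothesis).
Template: `stub_rhsSup_of_constLLN` (…RhsSupOfConstLLN), now with a NON-ZERO limit: the pointwise/deterministic twins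
of [Rp]/[Rd] for a scalar weight (`abs_rp_core_le` with no `ū`-term, no centring `∫ div ψ = 0`), the generic assembly
`rhsA_tendsto_of_constLLN` for any continuous nonnegative kernel family of mass one (cut-off slice process, `L²`
envelope by an affine velocity average, stationarity + deterministic lemma per slice, time integration in
probability), and the cone instance (`ρ̄ = ρ_r`, `ConeValue.rhoB_cone`: the mollified ceiling `stub_mollifiedCeilingConst`
is the dilute input once `2σ³ ≤ η₁`). Folklore; nothing is cited.
-/

namespace Summit.AtomisticToContinuum.HydrodynamicLimit.Theorems.HemisphereAffineSlaving

open scoped BigOperators Topology Classical ENNReal InnerProductSpace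
open Filter Set Function MeasureTheory
open Literature.Analysis.FunctionSpaces Literature.Analysis.FluidPDE

noncomputable section

open Literature.MathematicalPhysics.KineticTheory (T3 V3 localGibbsLaw gaussMeasure hsCompressibility hsPressure coneKernel)

/-- The dilute envelope for a scalar weight `|D| ≤ C₁`: `|D p_c(ρ̄, θ̄)| ≤ C₁ K η₁ Ē` on a block with
`ρ̄σ³ ≤ η₁ ≤ η_Z` (`p_c = pkin (Z − 1)`, `0 ≤ pkin ≤ (2/3)Ē`, `|Z − 1| ≤ K η₁`). [folklore] -/
theorem abs_weight_mul_pcoll_le {σ K ηZ η₁ C₁ D : ℝ} (hσ : 0 < σ) (hK : 0 ≤ K) (hη₁Z : η₁ ≤ ηZ)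
    (hZ : ∀ η : ℝ, 0 ≤ η → η ≤ ηZ → |hsCompressibility η - 1| ≤ K * η)
    {N : ℕ} {φ : ℕ → T3 → ℝ} {w : Cfg N} {x : T3} (hφ0 : ∀ y, 0 ≤ φ N y) (hD : |D| ≤ C₁)
    (hhi : rhoB φ N w x * σ ^ 3 ≤ η₁) :
    |D * pcoll σ (rhoB φ N w x) (thetaB φ N w x)| ≤ C₁ * K * η₁ * EB φ N w x := by
  have hE0 : 0 ≤ EB φ N w x := EB_nonneg hφ0
  have hη0 : 0 ≤ rhoB φ N w x * σ ^ 3 := mul_nonneg (rhoB_nonneg hφ0) (pow_nonneg hσ.le 3)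
  have hη₁ : 0 ≤ η₁ := hη0.trans hhi
  obtain ⟨hP0, hPE⟩ := RhsEnvelope.pkin_nonneg_le (w := w) (x := x) hφ0
  have hZm : |hsCompressibility (rhoB φ N w x * σ ^ 3) - 1| ≤ K * η₁ :=
    (hZ _ hη0 (hhi.trans hη₁Z)).trans (mul_le_mul_of_nonneg_left hhi hK)
  have hC₁ : 0 ≤ C₁ := (abs_nonneg _).trans hD
  rw [RhsEnvelope.pcoll_eq_pkin_mul, abs_mul, abs_mul, abs_of_nonneg hP0]
  calc |D| * (pkin φ N w x * |hsCompressibility (rhoB φ N w x * σ ^ 3) - 1|)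
      ≤ C₁ * ((2 / 3 * EB φ N w x) * (K * η₁)) :=
        mul_le_mul hD (mul_le_mul hPE hZm (abs_nonneg _) (by positivity)) (by positivity) hC₁
    _ ≤ C₁ * K * η₁ * EB φ N w x := by
        have h : 0 ≤ C₁ * K * η₁ * EB φ N w x := by positivity
        nlinarith [h]

/-- **Deterministic smallness of the slice for a scalar weight** (twin of [Rd] `abs_integral_eulerW_pcoll_le_of_lln`,
NON-ZERO limit): given `e > 0` there is `ε' > 0` such that on every dilute configuration whose block fields are
`ε'`-close in `L²(𝕋³)` to `(1, 0, 3θ/2)`, `|∫ₓ g p_c(ρ̄, θ̄) − θ (Z(σ³) − 1) ∫ₓ g| ≤ e` for every continuous `|g| ≤ C₁`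
(pointwise twin of [Rp]: `abs_rp_core_le` with `S = 0`, empty blocks `p_c = 0`, `Z(0) = 1`; then domination by the
affine function `A₀ + A₁ q` of the LLN integrand, `rd_core_le`, `exists_abs_hsCompressibility_sub_le`). [folklore] -/
theorem abs_integral_weight_pcoll_sub_le_of_lln {θ σ K ηZ η₁ C₁ : ℝ} (hθ : 0 < θ) (hσ : 0 < σ) (hK : 0 ≤ K)
    (hη₁ : 0 < η₁) (hη₁Z : η₁ ≤ ηZ) (hσZ : σ ^ 3 ≤ ηZ) (hC₁ : 0 ≤ C₁)
    (hZ : ∀ η : ℝ, 0 ≤ η → η ≤ ηZ → |hsCompressibility η - 1| ≤ K * η)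
    (hZc : ContinuousAt hsCompressibility (σ ^ 3)) {e : ℝ} (he : 0 < e) :
    ∃ ε' : ℝ, 0 < ε' ∧ ∀ (N : ℕ) (φ : ℕ → T3 → ℝ), Continuous (φ N) → (∀ y, 0 ≤ φ N y) →
      ∀ g : T3 → ℝ, Continuous g → (∀ x, |g x| ≤ C₁) → ∀ w : Cfg N, (∀ x, rhoB φ N w x * σ ^ 3 ≤ η₁) →
      ∫ x, ((rhoB φ N w x - 1) ^ 2 + ‖mB φ N w x‖ ^ 2 + (EB φ N w x - 3 / 2 * θ) ^ 2) ≤ ε' →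
      |(∫ x, g x * pcoll σ (rhoB φ N w x) (thetaB φ N w x)) - θ * (hsCompressibility (σ ^ 3) - 1) * ∫ x, g x| ≤ e := by
  -- adapted from the proofs of `abs_eulerW_pcoll_sub_le_pointwise` (…RhsPointwise) and
  -- `abs_integral_eulerW_pcoll_le_of_lln` (…RhsDeterministic)
  have hσ3 : 0 < σ ^ 3 := pow_pos hσ 3
  obtain ⟨e₀, he₀, he₀b⟩ : ∃ e₀ : ℝ, 0 < e₀ ∧ C₁ * θ * e₀ ≤ e / 4 :=
    ⟨e / (4 * (C₁ * θ + 1)), by positivity, mul_quarter_div_le (by positivity) he.le⟩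
  obtain ⟨M, hM0, hM⟩ := exists_abs_hsCompressibility_sub_le (η₁ := η₁) hσ hK hη₁ hη₁Z hσZ hZ hZc he₀
  obtain ⟨δ, hδ, hδb⟩ : ∃ δ : ℝ, 0 < δ ∧ δ * (2 / 3 * C₁ * K * η₁ + 3 * C₁ * K * σ ^ 3 * θ) ≤ e / 4 :=
    ⟨e / (4 * (2 / 3 * C₁ * K * η₁ + 3 * C₁ * K * σ ^ 3 * θ + 1)), by positivity, by
      rw [mul_comm]; exact mul_quarter_div_le (by positivity) he.le⟩
  obtain ⟨A₁, hA₁0, hA₁⟩ : ∃ A₁ : ℝ, 0 ≤ A₁ ∧ A₁ = C₁ * (2 / 3 * K * η₁ * δ⁻¹ + K * σ ^ 3 / 3 + θ * M) +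
      2 * C₁ * K * σ ^ 3 * (1 + 3 / 2 * θ * δ⁻¹) := ⟨_, by positivity, rfl⟩
  refine ⟨e / (4 * (A₁ + 1)), by positivity, ?_⟩
  intro N φ hφc hφ0 g hgc hg w hdil hL2
  -- pointwise comparison `|g p_c − g θ(Z(σ³) − 1)| ≤ [Rp]-bound` (scalar core with `S = 0`)
  have hpw : ∀ x, |g x * pcoll σ (rhoB φ N w x) (thetaB φ N w x) - g x * (θ * (hsCompressibility (σ ^ 3) - 1))| ≤
      C₁ * (2 / 3 * K * η₁ * |EB φ N w x - 3 / 2 * θ| + K * σ ^ 3 / 3 * ‖mB φ N w x‖ ^ 2 +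
        θ * |hsCompressibility (rhoB φ N w x * σ ^ 3) - hsCompressibility (σ ^ 3)|) +
        2 * C₁ * K * σ ^ 3 * (‖mB φ N w x‖ * EB φ N w x) := by
    intro x
    have hE0 : 0 ≤ EB φ N w x := EB_nonneg hφ0
    rcases (rhoB_nonneg (w := w) (x := x) hφ0).eq_or_lt with hρz | hρpos
    · have hpc0 : pcoll σ 0 (thetaB φ N w x) = 0 := by simp [pcoll, hsPressure]
      have hZ0 : hsCompressibility (0 * σ ^ 3) = 1 := by simp [hsCompressibility]
      rw [← hρz, hpc0, mul_zero, zero_sub, abs_neg, hZ0]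
      have e1 : |g x * (θ * (hsCompressibility (σ ^ 3) - 1))| = |g x| * (θ * |1 - hsCompressibility (σ ^ 3)|) := by
        rw [abs_mul, abs_mul, abs_of_nonneg hθ.le, abs_sub_comm]
      have e2 : |g x| * (θ * |1 - hsCompressibility (σ ^ 3)|) ≤ C₁ * (θ * |1 - hsCompressibility (σ ^ 3)|) :=
        mul_le_mul_of_nonneg_right (hg x) (by positivity)
      have e3 : 0 ≤ C₁ * (2 / 3 * K * η₁ * |EB φ N w x - 3 / 2 * θ|) := by positivity
      have e4 : 0 ≤ C₁ * (K * σ ^ 3 / 3 * ‖mB φ N w x‖ ^ 2) := by positivity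
      have e5 : 0 ≤ 2 * C₁ * K * σ ^ 3 * (‖mB φ N w x‖ * EB φ N w x) := by positivity
      rw [e1]
      linarith
    · have hp : pkin φ N w x = 2 / 3 * EB φ N w x - ‖mB φ N w x‖ ^ 2 / (3 * rhoB φ N w x) := by
        simp only [pkin, thetaB]
        field_simp
      obtain ⟨hp0, hpE⟩ := RhsEnvelope.pkin_nonneg_le (w := w) (x := x) hφ0
      have hz : |hsCompressibility (rhoB φ N w x * σ ^ 3) - 1| ≤ K * (rhoB φ N w x * σ ^ 3) :=
        hZ _ (by positivity) ((hdil x).trans hη₁Z)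
      have hη : K * (rhoB φ N w x * σ ^ 3) ≤ K * η₁ := mul_le_mul_of_nonneg_left (hdil x) hK
      have h := abs_rp_core_le (S := 0) (Zσ := hsCompressibility (σ ^ 3)) hθ.le hσ3.le hK hC₁ hρpos
        (norm_nonneg _) (hg x) (by rw [abs_zero]; positivity) hp hp0 hpE hz hη
      rw [RhsEnvelope.pcoll_eq_pkin_mul]
      simpa only [add_zero] using h
  set A₀ : ℝ := δ * (2 / 3 * C₁ * K * η₁ + 3 * C₁ * K * σ ^ 3 * θ) + C₁ * θ * e₀ with hA₀
  -- pointwise domination of the centred integrand by `A₀ + A₁ q`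
  have hpt : ∀ x, ‖g x * pcoll σ (rhoB φ N w x) (thetaB φ N w x) - θ * (hsCompressibility (σ ^ 3) - 1) * g x‖ ≤
      A₀ + A₁ * ((rhoB φ N w x - 1) ^ 2 + ‖mB φ N w x‖ ^ 2 + (EB φ N w x - 3 / 2 * θ) ^ 2) := by
    intro x
    rw [Real.norm_eq_abs, hA₁, hA₀, mul_comm (θ * (hsCompressibility (σ ^ 3) - 1)) (g x)]
    exact (hpw x).trans (rd_core_le hC₁ hK hη₁.le hσ3.le hθ.le hδ (mul_inv_cancel₀ hδ.ne') hM0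
      (norm_nonneg (mB φ N w x)) (by ring : EB φ N w x = EB φ N w x - 3 / 2 * θ + 3 / 2 * θ)
      (hM (rhoB φ N w x) (rhoB_nonneg hφ0) (hdil x)))
  -- integrability of the dominating function, of the centring term and of the slice integrand
  have hq : Continuous fun x => (rhoB φ N w x - 1) ^ 2 + ‖mB φ N w x‖ ^ 2 + (EB φ N w x - 3 / 2 * θ) ^ 2 := by
    simp only [rhoB_eq, mB_eq, EB_eq]
    fun_prop
  have hqi := hq.integrable_unitAddTorus
  have hDi : Integrable (fun x => A₀ + A₁ * ((rhoB φ N w x - 1) ^ 2 + ‖mB φ N w x‖ ^ 2 + (EB φ N w x - 3 / 2 * θ) ^ 2)) :=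
    (integrable_const _).add (hqi.const_mul A₁)
  have hGi : Integrable (fun x => θ * (hsCompressibility (σ ^ 3) - 1) * g x) := hgc.integrable_unitAddTorus.const_mul _
  have hFm : AEStronglyMeasurable (fun x => g x * pcoll σ (rhoB φ N w x) (thetaB φ N w x)) (volume : Measure T3) := by
    have hwx : Measurable fun x : T3 => ((w, x) : Cfg N × T3) := measurable_const.prodMk measurable_id
    have hpc : Measurable fun x : T3 => pcoll σ (rhoB φ N w x) (thetaB φ N w x) := by
      simpa only [Function.comp_def] using (measurable_pcoll_block σ hφc).comp hwx
    exact (show Measurable (fun x => g x * pcoll σ (rhoB φ N w x) (thetaB φ N w x)) from hgc.measurable.mul hpc).aestronglyMeasurable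
  have hFi : Integrable (fun x => g x * pcoll σ (rhoB φ N w x) (thetaB φ N w x)) := by
    refine (hDi.add hGi.norm).mono' hFm (ae_of_all _ fun x => ?_)
    have h := norm_le_norm_add_norm_sub' (g x * pcoll σ (rhoB φ N w x) (thetaB φ N w x))
      (θ * (hsCompressibility (σ ^ 3) - 1) * g x)
    have h' := hpt x
    simp only [Pi.add_apply]; linarith
  rw [← integral_const_mul, ← integral_sub hFi hGi]
  calc |∫ x, (g x * pcoll σ (rhoB φ N w x) (thetaB φ N w x) - θ * (hsCompressibility (σ ^ 3) - 1) * g x)|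
      = ‖∫ x, (g x * pcoll σ (rhoB φ N w x) (thetaB φ N w x) - θ * (hsCompressibility (σ ^ 3) - 1) * g x)‖ :=
        (Real.norm_eq_abs _).symm
    _ ≤ ∫ x, (A₀ + A₁ * ((rhoB φ N w x - 1) ^ 2 + ‖mB φ N w x‖ ^ 2 + (EB φ N w x - 3 / 2 * θ) ^ 2)) :=
        norm_integral_le_of_norm_le hDi (ae_of_all _ hpt)
    _ = A₀ + A₁ * ∫ x, ((rhoB φ N w x - 1) ^ 2 + ‖mB φ N w x‖ ^ 2 + (EB φ N w x - 3 / 2 * θ) ^ 2) := by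
        rw [integral_add (integrable_const _) (hqi.const_mul A₁), integral_const, integral_const_mul,
          probReal_univ, one_smul]
    _ ≤ A₀ + A₁ * (e / (4 * (A₁ + 1))) := by gcongr
    _ ≤ e := by rw [hA₀]; linarith [mul_quarter_div_le hA₁0 he.le]

/-- **`RhsA` at global equilibrium from the constant-profile LLN and the dilute ceiling (generic kernel).** For
`θ > 0`, `0 < σ ≤ 1/2`, `σ³, η₁ ≤ η_Z` (`|Z(η) − 1| ≤ Kη` on `[0, η_Z]`), `Z` continuous at `σ³`, a kernel family
(continuous, nonnegative, mass one) with `∫ₓ (ρ̄ − 1)² + |m̄|² + (Ē − 3θ/2)² → 0` in probability under the homogeneous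
law (time `0`) and no block denser than `η₁/σ³` on `[0, t]` w.h.p.: for `A` smooth on `[0, t]` and FIXED `τ ∈ [0, t]`,
`RhsA_N(τ) − θ (Z(σ³) − 1) ∫₀^τ∫ₓ tr A → 0` in probability. [folklore] -/
theorem rhsA_tendsto_of_constLLN {θ σ K ηZ η₁ : ℝ} (hθ : 0 < θ) (hσ : 0 < σ) (hhalf : σ ≤ 1 / 2) (hK : 0 ≤ K)
    (hη₁ : 0 < η₁) (hη₁Z : η₁ ≤ ηZ) (hσZ : σ ^ 3 ≤ ηZ)
    (hZK : ∀ η : ℝ, 0 ≤ η → η ≤ ηZ → |hsCompressibility η - 1| ≤ K * η)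
    (hZc : ContinuousAt hsCompressibility (σ ^ 3)) (Φ : Flows σ) {t : ℝ} (ht : 0 < t)
    {φ : ℕ → T3 → ℝ} (hφc : ∀ N, Continuous (φ N)) (hφ0 : ∀ N y, 0 ≤ φ N y) (hφ1 : ∀ N, ∫ y, φ N y = 1)
    (hLLN : ∀ δ : ℝ, 0 < δ → Tendsto (fun N : ℕ => localGibbsLaw σ (fun _ => 1) (fun _ => 0) (fun _ => θ) N (Φ N)
      {z | δ < ∫ x, ((rhoB φ N z x - 1) ^ 2 + ‖mB φ N z x‖ ^ 2 + (EB φ N z x - 3 / 2 * θ) ^ 2)}) atTop (𝓝 0))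
    (hDil : Tendsto (fun N : ℕ => localGibbsLaw σ (fun _ => 1) (fun _ => 0) (fun _ => θ) N (Φ N)
      {z | ∃ s ∈ Icc 0 t, ∃ x : T3, η₁ < rhoB φ N ((Φ N).flow s z) x * σ ^ 3}) atTop (𝓝 0))
    {A : ℝ → T3 → Fin 3 → Fin 3 → ℝ} (hA : SmoothMatrixOn (Icc 0 t) A) {τ : ℝ} (hτ : τ ∈ Icc 0 t)
    {δ : ℝ} (hδ : 0 < δ) :
    Tendsto (fun N : ℕ => localGibbsLaw σ (fun _ => 1) (fun _ => 0) (fun _ => θ) N (Φ N)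
      {z | δ < |RhsA σ Φ φ A N z τ - θ * (hsCompressibility (σ ^ 3) - 1) * ∫ s in Icc 0 τ, ∫ x, trW A s x|})
      atTop (𝓝 0) := by
  -- adapted from the proof of `stub_rhsSup_of_constLLN` (module …RhsSupOfConstLLN)
  have hP : ∀ N, IsProbabilityMeasure (localGibbsLaw σ (fun _ => 1) (fun _ => 0) (fun _ => θ) N (Φ N)) :=
    fun N => Literature.MathematicalPhysics.KineticTheory.isProbabilityMeasure_localGibbsLaw
      continuous_const continuous_const continuous_const (fun _ => one_pos) (fun _ => hθ) hhalf N (Φ N)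
  -- the weight: a bound on `[0, t] × 𝕋³` and the time-clamped, jointly continuous trace `g`
  have hAS : Torus.IsSmoothSpaceTimeOn (Icc 0 t) (fun s x => trW A s x) := by
    simpa only [trW] using Torus.IsSmoothSpaceTimeOn.sum (s := (Finset.univ : Finset (Fin 3)))
      (w := fun a s x => A s x a a) fun a _ => hA a a
  obtain ⟨C₀, hC₀⟩ := hAS.exists_norm_le_of_isCompact isCompact_Icc Subset.rfl
  have hC₁ : 0 ≤ |C₀| := abs_nonneg _
  obtain ⟨g, hg⟩ : ∃ g : ℝ × T3 → ℝ, ∀ q, g q = trW A (projIcc 0 t ht.le q.1) q.2 := ⟨_, fun _ => rfl⟩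
  have hgc : Continuous g := by rw [show g = _ from funext hg]; exact continuous_comp_projIcc ht hAS
  have hgb : ∀ s x, |g (s, x)| ≤ |C₀| := fun s x => by
    rw [hg, ← Real.norm_eq_abs]; exact (hC₀ _ (projIcc 0 t ht.le s).2 x).trans (le_abs_self _)
  have hgA : ∀ {s}, s ∈ Icc 0 t → ∀ x, g (s, x) = trW A s x := fun hs x => by simp only [hg, projIcc_of_mem ht.le hs]
  -- the slice functionals `aF(s, w) = ∫ₓ g p_c`, `bF(s) = ∫ₓ g`, `Y = aF − θ(Z(σ³) − 1) bF`
  obtain ⟨aF, haF⟩ : ∃ aF : (N : ℕ) → ℝ → Cfg N → ℝ, ∀ N s w, aF N s w =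
      ∫ x, g (s, x) * pcoll σ (rhoB φ N w x) (thetaB φ N w x) := ⟨_, fun _ _ _ => rfl⟩
  obtain ⟨bF, hbF⟩ : ∃ bF : ℝ → ℝ, ∀ s, bF s = ∫ x, g (s, x) := ⟨_, fun _ => rfl⟩
  obtain ⟨Y, hY⟩ : ∃ Y : (N : ℕ) → ℝ → Cfg N → ℝ, ∀ N s w, Y N s w =
      aF N s w - θ * (hsCompressibility (σ ^ 3) - 1) * bF s := ⟨_, fun _ _ _ => rfl⟩
  have haFm : ∀ N, Measurable fun q : ℝ × Cfg N => aF N q.1 q.2 := fun N => by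
    simpa only [haF] using EnvelopeA.measurable_integral_trSlice σ (hφc N) hgc
  have hbFm : Measurable bF := by
    simpa only [show bF = _ from funext hbF] using (hgc.stronglyMeasurable.integral_prod_right' (ν := volume)).measurable
  have hYm : ∀ N, Measurable (uncurry (Y N)) := fun N => by
    have h : Measurable fun q : ℝ × Cfg N => aF N q.1 q.2 - θ * (hsCompressibility (σ ^ 3) - 1) * bF q.1 :=
      (haFm N).sub ((hbFm.comp measurable_fst).const_mul _)
    simpa only [hY, Function.uncurry_def] using h
  have hbFb : ∀ s, |bF s| ≤ |C₀| := fun s => by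
    rw [hbF, ← Real.norm_eq_abs]
    have h := norm_integral_le_of_norm_le_const (μ := (volume : Measure T3)) (C := |C₀|)
      (f := fun x => g (s, x)) (ae_of_all _ fun x => by rw [Real.norm_eq_abs]; exact hgb s x)
    simpa using h
  have hcZ : |θ * (hsCompressibility (σ ^ 3) - 1)| ≤ θ * (K * σ ^ 3) := by
    rw [abs_mul, abs_of_pos hθ]; exact mul_le_mul_of_nonneg_left (hZK _ (pow_pos hσ 3).le hσZ) hθ.le
  -- the dilute set, the affine velocity-average envelope, the measurable modification of the flow
  set S : (N : ℕ) → Set (Cfg N) := fun N => {w | ∀ x, rhoB φ N w x * σ ^ 3 ≤ η₁} with hS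
  have hSm : ∀ N, MeasurableSet (S N) := fun N => (isClosed_setOf_dilute (hφc N) σ η₁).measurableSet
  have hgv : MemLp (fun v : V3 => |C₀| * K * η₁ / 2 * ‖v‖ ^ 2 + θ * (K * σ ^ 3) * |C₀|) 2 (gaussMeasure (0 : V3) θ) :=
    ((memLp_two_norm_pow_gaussMeasure_zero θ 2).const_mul _).add (memLp_const _)
  have hA2 := fun N => memLp_two_velAvg_localGibbsLaw_const one_pos hθ hhalf 0 Φ N _ hgv
  have hI2 := fun N => integral_velAvg_sq_le_localGibbsLaw_const one_pos hθ hhalf 0 Φ N _ hgv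
  choose F hFm hF using fun N => exists_measurable_flow Φ N
  have hgood : ∀ N, ∀ᵐ z ∂(localGibbsLaw σ (fun _ => 1) (fun _ => 0) (fun _ => θ) N (Φ N)), z ∈ (Φ N).good :=
    fun N => ae_iff.2 (localGibbsLaw_compl_good' (Φ N))
  have hFae : ∀ N s, ∀ᵐ z ∂(localGibbsLaw σ (fun _ => 1) (fun _ => 0) (fun _ => θ) N (Φ N)),
      F N (s, z) = (Φ N).flow s z := fun N s => (hgood N).mono fun z hz => hF N s z hz
  have hinv := fun N s => map_flow_localGibbsLaw_const σ 1 θ 0 N (Φ N) s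
  obtain ⟨W, hW⟩ : ∃ W : (N : ℕ) → ℝ → Cfg N → ℝ, ∀ N s, W N s = fun w =>
      (S N).indicator (fun _ => (1 : ℝ)) w * Y N s w := ⟨_, fun _ _ => rfl⟩
  have hWm : ∀ N s, Measurable (W N s) := fun N s => by
    rw [hW]; exact (measurable_const.indicator (hSm N)).mul (hYm N).of_uncurry_left
  have hWle : ∀ N s w, |W N s w| ≤ ((N : ℝ) + 1)⁻¹ * ∑ i : Fin (N + 1),
      (|C₀| * K * η₁ / 2 * ‖(w i).2‖ ^ 2 + θ * (K * σ ^ 3) * |C₀|) := fun N s w => by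
    have h3 : |C₀| * K * η₁ * (((N + 1 : ℕ) : ℝ)⁻¹ * configEnergy w) + θ * (K * σ ^ 3) * |C₀| =
        ((N : ℝ) + 1)⁻¹ * ∑ i : Fin (N + 1), (|C₀| * K * η₁ / 2 * ‖(w i).2‖ ^ 2 + θ * (K * σ ^ 3) * |C₀|) := by
      have hN : (N : ℝ) + 1 ≠ 0 := by positivity
      rw [Finset.sum_add_distrib, Finset.sum_const, Finset.card_univ, Fintype.card_fin, nsmul_eq_mul,
        ← Finset.mul_sum, Nat.cast_succ, configEnergy]
      field_simp
    rw [hW]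
    by_cases hw : w ∈ S N
    · simp only [Set.indicator_of_mem hw, one_mul]
      have h1 : |aF N s w| ≤ |C₀| * K * η₁ * (((N + 1 : ℕ) : ℝ)⁻¹ * configEnergy w) := by
        rw [haF, ← Real.norm_eq_abs]
        exact EnvelopeA.norm_integral_le_of_abs_le_EB (hφc N) (hφ1 N) fun x =>
          abs_weight_mul_pcoll_le hσ hK hη₁Z hZK (hφ0 N) (hgb s x) (hw x)
      have h2 : |θ * (hsCompressibility (σ ^ 3) - 1) * bF s| ≤ θ * (K * σ ^ 3) * |C₀| := by
        rw [abs_mul]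
        exact mul_le_mul hcZ (hbFb s) (abs_nonneg _) (by positivity)
      rw [hY, ← h3]
      exact (abs_sub _ _).trans (add_le_add h1 h2)
    · simp only [Set.indicator_of_notMem hw, zero_mul, abs_zero]
      exact mul_nonneg (by positivity) (Finset.sum_nonneg fun i _ => by positivity)
  obtain ⟨X, hX⟩ : ∃ X : (N : ℕ) → ℝ → Cfg N → ℝ, ∀ N s, X N s = fun z => |W N s (F N (s, z))| :=
    ⟨_, fun _ _ => rfl⟩
  -- (i) joint measurability, (ii) square integrability, (iii) uniform second moments (stationarity, envelope)
  have hXm : ∀ N, Measurable (uncurry (X N)) := fun N => by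
    have hWu : Measurable fun q : ℝ × Cfg N => W N q.1 q.2 := by
      simp only [hW]
      exact ((measurable_const.indicator (hSm N)).comp measurable_snd).mul (hYm N)
    have h1 : Measurable fun q : ℝ × Cfg N => W N q.1 (F N q) := hWu.comp (measurable_fst.prodMk (hFm N))
    simpa only [hX, Function.uncurry_def] using h1.abs
  have hWL2 : ∀ N s, MemLp (W N s) 2 (localGibbsLaw σ (fun _ => 1) (fun _ => 0) (fun _ => θ) N (Φ N)) :=
    fun N s => MemLp.of_le (hA2 N) (hWm N s).aestronglyMeasurable (ae_of_all _ fun w => by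
      rw [Real.norm_eq_abs, Real.norm_eq_abs]; exact (hWle N s w).trans (le_abs_self _))
  have hXL2 : ∀ N, ∀ s ∈ Icc 0 t, MemLp (X N s) 2 (localGibbsLaw σ (fun _ => 1) (fun _ => 0) (fun _ => θ) N (Φ N)) :=
    fun N s _ => by rw [hX]; exact (memLp_comp_of_map_eq ((Φ N).measurable_flow s) (hinv N s) (hFae N s) (hWL2 N s)).abs
  have hXC : ∀ N, ∀ s ∈ Icc 0 t, ∫ z, X N s z ^ 2 ∂(localGibbsLaw σ (fun _ => 1) (fun _ => 0) (fun _ => θ) N (Φ N)) ≤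
      ∫ v, (|C₀| * K * η₁ / 2 * ‖v‖ ^ 2 + θ * (K * σ ^ 3) * |C₀|) ^ 2 ∂(gaussMeasure (0 : V3) θ) :=
    fun N s _ => by
      simp only [hX, sq_abs]
      rw [integral_sq_comp_eq ((Φ N).measurable_flow s) (hinv N s) (hFae N s) (hWm N s)]
      refine le_trans (integral_mono_of_nonneg (ae_of_all _ fun w => sq_nonneg _) (hA2 N).integrable_sq
        (ae_of_all _ fun w => ?_)) (hI2 N)
      exact sq_le_sq' (abs_le.1 (hWle N s w)).1 (abs_le.1 (hWle N s w)).2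
  -- (iv) convergence in probability of each slice `s ∈ [0, t]`: stationarity and the deterministic lemma
  have hXlim : ∀ s ∈ Icc 0 t, ∀ η : ℝ, 0 < η → Tendsto (fun N : ℕ =>
      localGibbsLaw σ (fun _ => 1) (fun _ => 0) (fun _ => θ) N (Φ N) {z | η < |X N s z|}) atTop (𝓝 0) := by
    intro s hs η hη
    obtain ⟨ε', hε', Hε⟩ := abs_integral_weight_pcoll_sub_le_of_lln hθ hσ hK hη₁ hη₁Z hσZ hC₁ hZK hZc (half_pos hη)
    refine tendsto_of_tendsto_of_tendsto_of_le_of_le tendsto_const_nhds (hLLN ε' hε') (fun N => zero_le) fun N => ?_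
    have hsub : {w : Cfg N | η < |W N s w|} ⊆
        {z | ε' < ∫ x, ((rhoB φ N z x - 1) ^ 2 + ‖mB φ N z x‖ ^ 2 + (EB φ N z x - 3 / 2 * θ) ^ 2)} := by
      intro w hw
      simp only [mem_setOf_eq] at hw ⊢
      by_contra hle
      push Not at hle
      rw [hW] at hw
      by_cases hwS : w ∈ S N
      · simp only [Set.indicator_of_mem hwS, one_mul] at hw
        have h := Hε N φ (hφc N) (hφ0 N) (fun x => g (s, x)) (by fun_prop) (hgb s) w hwS hle
        rw [hY, haF, hbF] at hw
        linarith
      · simp only [Set.indicator_of_notMem hwS, zero_mul, abs_zero] at hw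
        linarith
    calc localGibbsLaw σ (fun _ => 1) (fun _ => 0) (fun _ => θ) N (Φ N) {z | η < |X N s z|}
        = localGibbsLaw σ (fun _ => 1) (fun _ => 0) (fun _ => θ) N (Φ N) {z | η < |W N s (F N (s, z))|} := by
          simp only [hX, abs_abs]
      _ ≤ localGibbsLaw σ (fun _ => 1) (fun _ => 0) (fun _ => θ) N (Φ N) {w | η < |W N s w|} :=
          measure_event_comp_le ((Φ N).measurable_flow s) (hinv N s) (hFae N s) (W N s) η
      _ ≤ _ := measure_mono hsub
  -- the time-integral lemma on `[0, t]`; then `|RhsA(τ) − θ(Z−1)∫₀^τ∫ tr A| ≤ ∫₀ᵗ X ds` on good, dilute data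
  have hmain := tendsto_measure_setIntegral_of_forall
    (fun N => localGibbsLaw σ (fun _ => 1) (fun _ => 0) (fun _ => θ) N (Φ N)) hP ht.le X hXm hXL2 hXC hXlim δ hδ
  refine tendsto_of_tendsto_of_tendsto_of_le_of_le tendsto_const_nhds (by simpa using hmain.add hDil)
    (fun N => zero_le) fun N => ?_
  haveI := hP N
  refine (measure_mono_ae ?_).trans (measure_union_le _ _)
  filter_upwards [hgood N, ae_integrableOn_Icc_of_sq_le _ (hXm N) (hXL2 N) (hXC N)] with z hz hzi
  intro hzE
  replace hzE : δ < |RhsA σ Φ φ A N z τ - θ * (hsCompressibility (σ ^ 3) - 1) * ∫ s in Icc 0 τ, ∫ x, trW A s x| := hzE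
  by_cases hBd : ∃ s ∈ Icc 0 t, ∃ x : T3, η₁ < rhoB φ N ((Φ N).flow s z) x * σ ^ 3
  · exact Or.inr hBd
  refine Or.inl ?_
  push Not at hBd
  show δ < |∫ s in Icc 0 t, X N s z|
  by_contra hA'
  push Not at hA'
  have hXnn : ∀ s, 0 ≤ X N s z := fun s => by rw [hX]; exact abs_nonneg _
  have hdS : ∀ s ∈ Icc 0 t, (Φ N).flow s z ∈ S N := fun s hs x => hBd s hs x
  have hτt : ∀ {s}, s ∈ Icc 0 τ → s ∈ Icc 0 t := fun hs => ⟨hs.1, hs.2.trans hτ.2⟩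
  have hslice : ∀ s ∈ Icc 0 τ, X N s z = |Y N s ((Φ N).flow s z)| := fun s hs => by
    simp only [hX, hW, hF N s z hz, Set.indicator_of_mem (hdS s (hτt hs)), one_mul]
  -- integrability of the two slice functionals on `[0, τ]`
  have haI : IntegrableOn (fun s => aF N s ((Φ N).flow s z)) (Icc 0 τ) := by
    have ham : Measurable fun s => aF N s ((Φ N).flow s z) :=
      (haFm N).comp (measurable_id.prodMk (measurable_orbit Φ hz))
    refine Measure.integrableOn_of_bounded (M := |C₀| * K * η₁ * (((N + 1 : ℕ) : ℝ)⁻¹ * configEnergy z))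
      measure_Icc_lt_top.ne ham.aestronglyMeasurable ((ae_restrict_mem measurableSet_Icc).mono fun s hs => ?_)
    rw [haF, ← configEnergy_orbit Φ hz s]
    exact EnvelopeA.norm_integral_le_of_abs_le_EB (hφc N) (hφ1 N) fun x =>
      abs_weight_mul_pcoll_le hσ hK hη₁Z hZK (hφ0 N) (hgb s x) (hdS s (hτt hs) x)
  have hbI : IntegrableOn bF (Icc 0 τ) := Measure.integrableOn_of_bounded measure_Icc_lt_top.ne hbFm.aestronglyMeasurable
    (ae_of_all _ fun s => by rw [Real.norm_eq_abs]; exact hbFb s)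
  -- the identity `RhsA(τ) − θ(Z−1)∫₀^τ∫ tr A = ∫₀^τ Y(s, Φ_s z) ds` and the conclusion
  have hR : RhsA σ Φ φ A N z τ = ∫ s in Icc 0 τ, aF N s ((Φ N).flow s z) := by
    unfold RhsA
    refine setIntegral_congr_fun measurableSet_Icc fun s hs => ?_
    rw [haF]; exact integral_congr_ae (ae_of_all _ fun x => by simp only [hgA (hτt hs)])
  have hB : ∫ s in Icc 0 τ, ∫ x, trW A s x = ∫ s in Icc 0 τ, bF s := by
    refine setIntegral_congr_fun measurableSet_Icc fun s hs => ?_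
    rw [hbF]; exact integral_congr_ae (ae_of_all _ fun x => by simp only [hgA (hτt hs)])
  have hId : RhsA σ Φ φ A N z τ - θ * (hsCompressibility (σ ^ 3) - 1) * ∫ s in Icc 0 τ, ∫ x, trW A s x =
      ∫ s in Icc 0 τ, Y N s ((Φ N).flow s z) := by
    rw [hR, hB, ← integral_const_mul, ← integral_sub haI (hbI.const_mul _)]
    simp only [hY]
  have h1 : |RhsA σ Φ φ A N z τ - θ * (hsCompressibility (σ ^ 3) - 1) * ∫ s in Icc 0 τ, ∫ x, trW A s x| ≤
      ∫ s in Icc 0 τ, X N s z := by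
    rw [hId, ← Real.norm_eq_abs]
    refine (norm_integral_le_integral_norm _).trans (le_of_eq (setIntegral_congr_fun measurableSet_Icc fun s hs => ?_))
    rw [Real.norm_eq_abs, hslice s hs]
  have h2 : ∫ s in Icc 0 τ, X N s z ≤ ∫ s in Icc 0 t, X N s z :=
    setIntegral_mono_set hzi (ae_of_all _ fun s => hXnn s) (Icc_subset_Icc_right hτ.2).eventuallyLE
  linarith [(le_abs_self _).trans hA']

/-- **Registered stub [R0C] `stub_rhsA_cone_const` (THE VALUE `RhsA` AT GLOBAL EQUILIBRIUM, CONE kernel of fixed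
radius; equilibrium rung of [TS], line `hemisphere-affine-slaving`, crux stmt-AtomisticToContinuum-9518).** Given the
constant-profile LLN for the cone-kernel block fields (time `0`): for `σ < σ₀(θ)`, every flow family, `t > 0`,
`0 < r < 1/4`, `A` smooth on `[0, t]` and fixed `τ ∈ [0, t]`, `RhsA[b_r](τ) → θ (Z(σ³) − 1) ∫₀^τ∫ₓ tr A` in probability
— `rhsA_tendsto_of_constLLN` with the cone kernel (continuous, nonnegative, mass one) and the mollified ceiling
`stub_mollifiedCeilingConst` (`ρ̄ = ρ_r ≤ 2` on `[0, t]` w.h.p., `ConeValue.rhoB_cone`, `2σ³ ≤ η₁`) as the dilute input;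
`σ₀ = min(σ_LLN, σ_ceiling, η₁, 1/2)`, `η₁ = min(η_Z, η_c/2)`. [folklore] -/
theorem stub_rhsA_cone_const : (∃ σ₀ : ℝ, 0 < σ₀ ∧ ∀ σ : ℝ, 0 < σ → σ < σ₀ → ∀ θ : ℝ, 0 < θ → ∀ (Φ : Flows σ) (r : ℝ), 0 < r → r < 1 / 4 → ∀ δ : ℝ, 0 < δ → Tendsto (fun N : ℕ => Literature.MathematicalPhysics.KineticTheory.localGibbsLaw σ (fun _ => 1) (fun _ => 0) (fun _ => θ) N (Φ N) {z | δ < ∫ x, ((rhoB (fun (_ : ℕ) (y : T3) => Literature.MathematicalPhysics.KineticTheory.coneKernel r y 0) N z x - 1) ^ 2 + ‖mB (fun (_ : ℕ) (y : T3) => Literature.MathematicalPhysics.KineticTheory.coneKernel r y 0) N z x‖ ^ 2 + (EB (fun (_ : ℕ) (y : T3) => Literature.MathematicalPhysics.KineticTheory.coneKernel r y 0) N z x - 3 / 2 * θ) ^ 2)}) atTop (𝓝 0)) → ∀ θ : ℝ, 0 < θ → ∃ σ₀ : ℝ, 0 < σ₀ ∧ ∀ σ : ℝ, 0 < σ → σ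 < σ₀ → ∀ (Φ : Flows σ) (t : ℝ), 0 < t → ∀ (r : ℝ), 0 < r → r < 1 / 4 → ∀ (A : ℝ → T3 → Fin 3 → Fin 3 → ℝ), SmoothMatrixOn (Icc 0 t) A → ∀ τ ∈ Icc 0 t, ∀ δ : ℝ, 0 < δ → Tendsto (fun N : ℕ => Literature.MathematicalPhysics.KineticTheory.localGibbsLaw σ (fun _ => 1) (fun _ => 0) (fun _ => θ) N (Φ N) {z | δ < |RhsA σ Φ (fun (_ : ℕ) (y : T3) => Literature.MathematicalPhysics.KineticTheory.coneKernel r y 0) A N z τ - θ * (Literature.MathematicalPhysics.KineticTheory.hsCompressibility (σ ^ 3) - 1) * ∫ s in Icc 0 τ, ∫ x, trW A s x|}) atTop (𝓝 0) := by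
  intro hL θ hθ
  -- constants of the equation of state; radii: the cone LLN, the mollified ceiling, `σ ≤ η₁`, `σ ≤ 1/2`
  obtain ⟨ηZ, hηZ, K, hK, hZK⟩ := stub_hsCompressibility_linear
  obtain ⟨ηc, hηc, hZc⟩ := hsCompressibility_continuousOn
  obtain ⟨η₁, hη₁0, hη₁Z, hη₁c⟩ : ∃ η₁ : ℝ, 0 < η₁ ∧ η₁ ≤ ηZ ∧ η₁ ≤ ηc / 2 :=
    ⟨min ηZ (ηc / 2), lt_min hηZ (half_pos hηc), min_le_left _ _, min_le_right _ _⟩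
  obtain ⟨σL, hσL, HL⟩ := hL
  obtain ⟨σS, hσS, HS⟩ := stub_mollifiedCeilingConst θ hθ
  refine ⟨min (min σL σS) (min η₁ (1 / 2)), lt_min (lt_min hσL hσS) (lt_min hη₁0 (by norm_num)), ?_⟩
  intro σ hσ hlt Φ t ht r hr hr4 A hA τ hτ δ hδ
  have hltL : σ < σL := lt_of_lt_of_le hlt ((min_le_left _ _).trans (min_le_left _ _))
  have hltS : σ < σS := lt_of_lt_of_le hlt ((min_le_left _ _).trans (min_le_right _ _))
  have hση : σ ≤ η₁ := (lt_of_lt_of_le hlt ((min_le_right _ _).trans (min_le_left _ _))).le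
  have hhalf : σ ≤ 1 / 2 := (lt_of_lt_of_le hlt ((min_le_right _ _).trans (min_le_right _ _))).le
  have hσ3 : σ ^ 3 ≤ η₁ / 4 := by
    have h2 : σ ^ 2 ≤ 1 / 4 := by nlinarith
    nlinarith [show σ ^ 3 = σ * σ ^ 2 by ring]
  have hcontZ : ContinuousAt hsCompressibility (σ ^ 3) := hZc.continuousAt (Icc_mem_nhds (by positivity) (by linarith))
  have hcont : Continuous fun y : T3 => coneKernel r y 0 := by
    have h : Continuous fun y : T3 => Torus.euclidDist y (0 : T3) := by
      simpa only [Function.comp_def, id_eq] using Torus.continuous_euclidDist.comp (continuous_id.prodMk continuous_const)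
    unfold coneKernel
    exact continuous_const.mul ((continuous_const.sub (h.div_const r)).max continuous_const)
  refine rhsA_tendsto_of_constLLN (φ := fun (_ : ℕ) (y : T3) => coneKernel r y 0) hθ hσ hhalf hK hη₁0 hη₁Z
    (by linarith) hZK hcontZ Φ ht (fun _ => hcont)
    (fun _ y => (Literature.MathematicalPhysics.KineticTheory.coneKernel_mem_Icc hr y 0).1)
    (fun _ => Literature.MathematicalPhysics.KineticTheory.integral_coneKernel hr (by linarith) 0)
    (HL σ hσ hltL θ hθ Φ r hr hr4) ?_ hA hτ hδ
  -- the dilute ceiling `ρ̄σ³ ≤ η₁` on `[0, t]` from the mollified ceiling `ρ_r ≤ 2` (`2σ³ ≤ η₁`)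
  refine tendsto_of_tendsto_of_tendsto_of_le_of_le tendsto_const_nhds (HS σ hσ hltS Φ t r ht hr hr4)
    (fun N => zero_le) fun N => measure_mono ?_
  rintro z ⟨s, hs, x, hx⟩
  refine ⟨s, hs, x, ?_⟩
  rw [ConeValue.rhoB_cone] at hx
  by_contra hle
  push Not at hle
  have h := mul_le_mul_of_nonneg_right hle (pow_nonneg hσ.le 3)
  linarith

end

end Summit.AtomisticToContinuum.HydrodynamicLimit.Theorems.HemisphereAffineSlaving
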